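import Literature.Geometry.Lorentzian.CoordKornIdentity
import HarnessLib

/-!
# The weighted Korn inequality for the covariant derivative of a vector field

Topic `Literature/Geometry/Lorentzian`, coordinate tensor calculus `MetricCoord` (Riemannian metric
components `G` on an open set `V`). Everything here is PROVED; no definition and no statement of
`Prop` type is introduced.

From the pointwise Korn identity `|∇Y|² = 2|S(Y)|² − (div Y)² + Ric(Y,Y) + div((div Y)Y − ∇_Y Y)`
(`IsMetricOn.korn_pointwise`, `CoordKornIdentity.lean`), multiplying by a weight `e^{2u}` and
integrating by parts (`div(e^{2u}B) = e^{2u} div B + 2e^{2u} du(B)`, Peter–Paul on `du(∇_Y Y)`,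
completing the square in `div Y`):

* `IsMetricOn.apply_metric_sq_le` — `|Av|² ≤ Q(A)|v|²` (`Q(A) = tr_G G(A·,A·)`);
* `IsMetricOn.weightedKorn_pointwise` —
  `½ e^{2u}|∇Y|² ≤ 2e^{2u}|S(Y)|² + (3|∇u|² + ρ) e^{2u}|Y|² + div(e^{2u}((div Y)Y − ∇_Y Y))`
  wherever `Ric(v,v) ≤ ρ|v|²`;
* **`IsMetricOn.integral_weightedKornGradient`** — for `Y` smooth with compact support in `V`,
  `u` smooth on `V` and `Ric ≤ ρ G` on `V`,
  `∫ √det g · e^{2u}|∇Y|² dμ ≤ 4 ∫ √det g · e^{2u}|S(Y)|² dμ + 2 ∫ √det g · e^{2u}(3|∇u|² + ρ)|Y|² dμ`.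
  With `e^{2u} = e^{2σ/x}x⁴` this passes from the Killing operator `S(Y)` (controlled near the
  boundary by (5.12), `CoordWeightedKornBoundary.lean`) to `x²∇Y`, as needed to absorb the coupling
  term `sym K(∇Y·,·)` of the `γ`-row of `P*` in the boundary coercivity estimate (3.4) of
  Chruściel–Delay 2003 (proof of Thm. 5.9; cf. (2.14), Prop. 3.1, Prop. 3.3).

## References

* P. T. Chruściel, E. Delay, Mém. Soc. Math. Fr. 94 (2003), §2 (2.14), §3 Prop. 3.1/3.3, proof
  of Thm. 5.9. [ChruscielDelay2003]
* P. Petersen, *Riemannian Geometry*, 3rd ed., 2016, §9.2. [Petersen2016]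
-/

noncomputable section

set_option maxSynthPendingDepth 3

open Set Filter Module Function MeasureTheory
open scoped Topology ContDiff

namespace Literature.Geometry.Lorentzian

namespace MetricCoord

variable {E : Type*} [NormedAddCommGroup E] [NormedSpace ℝ E] [FiniteDimensional ℝ E]
  [CompleteSpace E] {ι : Type*} [Fintype ι] [DecidableEq ι] (b : Basis ι ℝ E)
  {G : E → E →L[ℝ] E →L[ℝ] ℝ} {V : Set E} {x : E} {Y : E → E} {u : E → ℝ}

/-! ### `|Av|² ≤ Q(A)|v|²` -/

omit [CompleteSpace E] [Fintype ι] [DecidableEq ι] in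
/-- **`G(Av, Av) ≤ Q(A) G(v,v)`** at a symmetric positive definite point (`Q(A) = tr_G G(A·,A·)` is
the Hilbert–Schmidt square norm, which dominates the operator norm). [cite: Petersen2016, §9.2] -/
theorem IsMetricOn.apply_metric_sq_le (hG : IsMetricOn G V) (hx : x ∈ V)
    (hpos : ∀ e : E, e ≠ 0 → 0 < G x e e) (A : E →L[ℝ] E) (v : E) :
    G x (A v) (A v) ≤ mtrAt G x ((G x).bilinearComp A A) * G x v v := by
  have hCS := apply_sq_le_normSqAt_mul hG hx hpos ((G x).comp A) v (A v)
  rw [ContinuousLinearMap.comp_apply, hG.normSqAt_metric_comp hx hpos A] at hCS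
  set m := G x (A v) (A v) with hm
  have hm0 : 0 ≤ m := by
    by_cases hz : A v = 0
    · simp [hm, hz]
    · exact (hpos _ hz).le
  have hQ0 : 0 ≤ mtrAt G x ((G x).bilinearComp A A) := hG.mtrAt_bilinearComp_nonneg hx hpos A
  have hv0 : 0 ≤ G x v v := by
    by_cases hz : v = 0
    · simp [hz]
    · exact (hpos _ hz).le
  by_cases hm' : m = 0
  · rw [hm']; positivity
  · have hmpos : 0 < m := lt_of_le_of_ne hm0 (Ne.symm hm')
    nlinarith

/-! ### The weighted pointwise inequality -/

omit [Fintype ι] [DecidableEq ι] in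
/-- **The weighted pointwise Korn inequality**: for `Y, u` smooth on `V`, at a positive definite
point `x ∈ V` where `Ric(v,v) ≤ ρ G(v,v)`,
`½ e^{2u}|∇Y|² ≤ 2 e^{2u}|S(Y)|² + (3|∇u|² + ρ) e^{2u}|Y|² + div(e^{2u}((div Y) Y − ∇_Y Y))`
(Korn identity, `div(e^{2u}B) = e^{2u}div B + 2e^{2u}du(B)`, `−(div Y)² − 2(div Y)du(Y) ≤ du(Y)²`,
`2 du(∇_Y Y) ≤ ½|∇Y|² + 2|∇u|²|Y|²`). [cite: ChruscielDelay2003, §2, (2.14)] -/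
theorem IsMetricOn.weightedKorn_pointwise (hG : IsMetricOn G V) (hx : x ∈ V)
    (hpos : ∀ e : E, e ≠ 0 → 0 < G x e e) (hY : ContDiffOn ℝ ∞ Y V) (hu : ContDiffOn ℝ ∞ u V)
    {ρ : ℝ} (hρ : ∀ v : E, ricAt G x v v ≤ ρ * G x v v) :
    2⁻¹ * (Real.exp (2 * u x) * mtrAt G x ((G x).bilinearComp (covDAt G Y x) (covDAt G Y x))) ≤
      2 * (Real.exp (2 * u x) * normSqAt G x (symAt ((G x).comp (covDAt G Y x))))
        + (3 * gradSqAt G u x + ρ) * (Real.exp (2 * u x) * G x (Y x) (Y x))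
        + divAt G (fun y ↦ Real.exp (2 * u y) • ((divAt G Y y) • Y y - covDAt G Y y (Y y))) x := by
  have hxs : V ∈ 𝓝 x := hG.mem_nhds hx
  have hYd : DifferentiableAt ℝ Y x := ((hY x hx).contDiffAt hxs).differentiableAt (by simp)
  have hud : DifferentiableAt ℝ u x := ((hu x hx).contDiffAt hxs).differentiableAt (by simp)
  have hdivd : DifferentiableAt ℝ (divAt G Y) x := (hG.hasFDerivAt_divAt hx hY).differentiableAt
  have hcovd : DifferentiableAt ℝ (fun y ↦ covDAt G Y y (Y y)) x :=
    (hG.hasFDerivAt_covDAt_self hx hY).differentiableAt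
  have hBd : DifferentiableAt ℝ (fun y ↦ (divAt G Y y) • Y y - covDAt G Y y (Y y)) x :=
    (hdivd.smul hYd).sub hcovd
  have hw : HasFDerivAt (fun y ↦ Real.exp (2 * u y))
      (Real.exp (2 * u x) • ((2 : ℝ) • fderiv ℝ u x)) x := (hud.hasFDerivAt.const_mul (2 : ℝ)).exp
  -- the Korn identity and the weighted divergence
  have hK := hG.korn_pointwise hx hpos hY
  have hdiv : divAt G (fun y ↦ Real.exp (2 * u y) • ((divAt G Y y) • Y y - covDAt G Y y (Y y))) x =
      Real.exp (2 * u x) * divAt G (fun y ↦ (divAt G Y y) • Y y - covDAt G Y y (Y y)) x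
        + Real.exp (2 * u x) * (2 * (divAt G Y x * fderiv ℝ u x (Y x)
          - fderiv ℝ u x (covDAt G Y x (Y x)))) := by
    rw [divAt_smul hw.differentiableAt hBd, hw.fderiv]
    simp only [_root_.smul_apply, map_sub, map_smul, smul_eq_mul]
    ring
  -- notation
  set w := Real.exp (2 * u x) with hwdef
  set A := covDAt G Y x with hA
  set Q := mtrAt G x ((G x).bilinearComp A A) with hQ
  set d := divAt G Y x with hd
  set t := fderiv ℝ u x (Y x) with ht
  set c := fderiv ℝ u x (A (Y x)) with hc
  set nY := G x (Y x) (Y x) with hnY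
  have hw0 : 0 < w := Real.exp_pos _
  have hnY0 : 0 ≤ nY := by
    by_cases hz : Y x = 0
    · simp [hnY, hz]
    · exact (hpos _ hz).le
  have hQ0 : 0 ≤ Q := hG.mtrAt_bilinearComp_nonneg hx hpos A
  -- the three bounds
  have h1 : -d ^ 2 - 2 * (d * t) ≤ t ^ 2 := by nlinarith [sq_nonneg (d + t)]
  have h2 : t ^ 2 ≤ gradSqAt G u x * nY := by
    have h := covector_apply_sq_le hG hx hpos (fderiv ℝ u x) (Y x)
    rwa [← gradSqAt_apply] at h
  have hg0 : 0 ≤ gradSqAt G u x := by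
    have hi := hG.isInvertible x hx
    rw [gradSqAt_apply, ← apply_sharpAt_apply hi]
    by_cases hz : sharpAt G x (fderiv ℝ u x) = 0
    · simp [hz]
    · exact (hpos _ hz).le
  have h3 : 2 * c ≤ 2⁻¹ * Q + 2 * (gradSqAt G u x * nY) := by
    have hc2 : c ^ 2 ≤ Q * (gradSqAt G u x * nY) := by
      have h := covector_apply_sq_le hG hx hpos (fderiv ℝ u x) (A (Y x))
      rw [← gradSqAt_apply] at h
      have hAv := hG.apply_metric_sq_le hx hpos A (Y x)
      calc c ^ 2 ≤ gradSqAt G u x * G x (A (Y x)) (A (Y x)) := h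
        _ ≤ gradSqAt G u x * (Q * nY) := mul_le_mul_of_nonneg_left hAv hg0
        _ = Q * (gradSqAt G u x * nY) := by ring
    have hPP := abs_le_peterPaul hc2 hQ0 (mul_nonneg hg0 hnY0) (by norm_num : (0 : ℝ) < 2⁻¹)
    have := le_abs_self c
    nlinarith
  have h4 : ricAt G x (Y x) (Y x) ≤ ρ * nY := hρ (Y x)
  -- assemble
  rw [hdiv]
  have key : w * Q = 2 * (w * normSqAt G x (symAt ((G x).comp A))) - w * d ^ 2
      + w * ricAt G x (Y x) (Y x)
      + w * divAt G (fun y ↦ (divAt G Y y) • Y y - covDAt G Y y (Y y)) x := by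
    rw [hK]; ring
  nlinarith [mul_le_mul_of_nonneg_left h1 hw0.le, mul_le_mul_of_nonneg_left h2 hw0.le,
    mul_le_mul_of_nonneg_left h3 hw0.le, mul_le_mul_of_nonneg_left h4 hw0.le]

/-! ### The integrated inequality -/

section Integral

variable [MeasurableSpace E] [BorelSpace E] (μ : Measure E) [μ.IsAddHaarMeasure]

/-- **The weighted Korn inequality**: for Riemannian metric components `G` on `V` with
`Ric ≤ ρ G` on `V`, `u` smooth on `V` and a vector field `Y` smooth on `V` with compact support
inside `V`,
`∫ √det g · e^{2u}|∇Y|²_G dμ ≤ 4 ∫ √det g · e^{2u}|S(Y)|²_G dμ + 2 ∫ √det g · e^{2u}(3|∇u|² + ρ)|Y|² dμ`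
(`|∇Y|² = tr_G G(∇·Y,∇·Y)`, `S(Y) = sym G(∇Y·,·)`): the weighted pointwise inequality integrated,
the divergence term dropping out by the divergence theorem.
[cite: ChruscielDelay2003, §2, (2.14)] -/
theorem IsMetricOn.integral_weightedKornGradient (hG : IsMetricOn G V)
    (hpos : ∀ y ∈ V, ∀ e : E, e ≠ 0 → 0 < G y e e) (hu : ContDiffOn ℝ ∞ u V) {ρ : ℝ}
    (hρ : ∀ y ∈ V, ∀ v : E, ricAt G y v v ≤ ρ * G y v v)
    (hY : ContDiffOn ℝ ∞ Y V) (hsupp : HasCompactSupport Y) (hYV : tsupport Y ⊆ V) :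
    ∫ y, sqrtDetGram G b y * (Real.exp (2 * u y)
        * mtrAt G y ((G y).bilinearComp (covDAt G Y y) (covDAt G Y y))) ∂μ ≤
      4 * ∫ y, sqrtDetGram G b y * (Real.exp (2 * u y)
          * normSqAt G y (symAt ((G y).comp (covDAt G Y y)))) ∂μ
        + 2 * ∫ y, sqrtDetGram G b y * (Real.exp (2 * u y)
          * ((3 * gradSqAt G u y + ρ) * G y (Y y) (Y y))) ∂μ := by
  -- notation
  set f₁ : E → ℝ := fun y ↦ Real.exp (2 * u y)
      * mtrAt G y ((G y).bilinearComp (covDAt G Y y) (covDAt G Y y)) with hf₁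
  set f₂ : E → ℝ := fun y ↦ Real.exp (2 * u y)
      * normSqAt G y (symAt ((G y).comp (covDAt G Y y))) with hf₂
  set f₃ : E → ℝ := fun y ↦ Real.exp (2 * u y) * ((3 * gradSqAt G u y + ρ) * G y (Y y) (Y y))
    with hf₃
  set B : E → E := fun y ↦ Real.exp (2 * u y) • ((divAt G Y y) • Y y - covDAt G Y y (Y y))
    with hBdef
  -- `Y` vanishes to first order off its support
  have hY0 : ∀ y ∉ tsupport Y, Y =ᶠ[𝓝 y] fun _ ↦ 0 := fun y hy ↦
    notMem_tsupport_iff_eventuallyEq.mp hy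
  have hcov0 : ∀ y ∉ tsupport Y, covDAt G Y y = 0 := fun y hy ↦ by
    ext e
    simp only [covDAt_apply, (hY0 y hy).self_of_nhds, (hY0 y hy).fderiv_eq, fderiv_fun_const,
      map_zero, _root_.zero_apply, add_zero, Pi.zero_apply]
  have hmtr0 : ∀ z, mtrAt G z ((G z).bilinearComp (0 : E →L[ℝ] E) (0 : E →L[ℝ] E)) = 0 :=
    fun z ↦ by rw [mtrAt_eq_sum b]; simp
  have hsym0 : ∀ z, symAt ((G z).comp (0 : E →L[ℝ] E)) = 0 := fun z ↦ by
    ext v w; simp [symAt_apply]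
  have hnorm0 : ∀ z, normSqAt G z (0 : E →L[ℝ] E →L[ℝ] ℝ) = 0 := fun z ↦ by
    simp [normSqAt_eq_traceCLM]
  have hf₁0 : ∀ y ∉ tsupport Y, f₁ y = 0 := fun y hy ↦ by
    simp only [hf₁, hcov0 y hy, hmtr0, mul_zero]
  have hf₂0 : ∀ y ∉ tsupport Y, f₂ y = 0 := fun y hy ↦ by
    simp only [hf₂, hcov0 y hy, hsym0, hnorm0, mul_zero]
  have hf₃0 : ∀ y ∉ tsupport Y, f₃ y = 0 := fun y hy ↦ by
    simp only [hf₃, (hY0 y hy).self_of_nhds, map_zero, mul_zero]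
  have hB0 : ∀ y ∉ tsupport Y, B y = 0 := fun y hy ↦ by
    simp only [hBdef, (hY0 y hy).self_of_nhds, hcov0 y hy, _root_.zero_apply, smul_zero, sub_zero]
  have hBt : tsupport B ⊆ tsupport Y :=
    closure_minimal (fun y hy ↦ by by_contra h; exact hy (hB0 y h)) (isClosed_tsupport Y)
  have hdivB0 : ∀ y ∉ tsupport Y, divAt G B y = 0 := fun y hy ↦
    divAt_eq_zero_of_eventuallyEq_zero (notMem_tsupport_iff_eventuallyEq.mp fun h ↦ hy (hBt h))
  -- smoothness on `V`
  have hws : ContDiffOn ℝ ∞ (fun y ↦ Real.exp (2 * u y)) V := (contDiffOn_const.mul hu).exp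
  have hA : ContDiffOn ℝ ∞ (covDAt G Y) V := hG.contDiffOn_covDAt hY
  have hf₁s : ContDiffOn ℝ ∞ f₁ V := by
    have heq : f₁ = fun y ↦ Real.exp (2 * u y) * ∑ i, ∑ j, ginv G b y i j *
        G y (covDAt G Y y (b i)) (covDAt G Y y (b j)) := by
      funext y
      simp only [hf₁]
      rw [mtrAt_eq_sum b]
      simp only [ContinuousLinearMap.bilinearComp_apply]
    rw [heq]
    refine hws.mul (ContDiffOn.sum fun i _ ↦ ContDiffOn.sum fun j _ ↦ ?_)
    exact (hG.contDiffOn_ginv b i j).mul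
      ((hG.contDiffOn.clm_apply (hA.clm_apply contDiffOn_const)).clm_apply
        (hA.clm_apply contDiffOn_const))
  have hf₂s : ContDiffOn ℝ ∞ f₂ V :=
    hws.mul (hG.contDiffOn_normSqAt (contDiffOn_symAt (hG.contDiffOn.clm_comp hA)))
  have hf₃s : ContDiffOn ℝ ∞ f₃ V :=
    hws.mul (((contDiffOn_const.mul (hG.contDiffOn_gradSqAt hu)).add contDiffOn_const).mul
      ((hG.contDiffOn.clm_apply hY).clm_apply hY))
  have hBs : ContDiffOn ℝ ∞ B V :=
    hws.smul (((hG.contDiffOn_divAt hY).smul hY).sub (hA.clm_apply hY))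
  have hBsupp : HasCompactSupport B := hsupp.mono' ((subset_tsupport _).trans hBt)
  have hBV : tsupport B ⊆ V := hBt.trans hYV
  have hdivs : ContDiffOn ℝ ∞ (divAt G B) V := hG.contDiffOn_divAt hBs
  -- integrability
  have hInt : ∀ {k : E → ℝ}, ContDiffOn ℝ ∞ k V → (∀ z ∉ tsupport Y, k z = 0) →
      Integrable (fun z ↦ sqrtDetGram G b z * k z) μ := fun hk hk0 ↦
    hG.integrable_sqrtDetGram_mul_of_subset b μ hpos hsupp (isClosed_tsupport Y) hYV hk hk0
  have hI₁ := hInt hf₁s hf₁0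
  have hI₂ := hInt hf₂s hf₂0
  have hI₃ := hInt hf₃s hf₃0
  have hId := hInt hdivs hdivB0
  -- the divergence integrates to zero
  have hdiv0 : ∫ y, sqrtDetGram G b y * divAt G B y ∂μ = 0 :=
    hG.integral_sqrtDetGram_mul_divAt_eq_zero b μ hpos hBs hBsupp hBV
  -- integrate the pointwise inequality
  have hmono : ∫ y, sqrtDetGram G b y * (2⁻¹ * f₁ y) ∂μ ≤
      ∫ y, sqrtDetGram G b y * (2 * f₂ y + f₃ y + divAt G B y) ∂μ := by
    refine integral_mono ?_ ?_ fun y ↦ ?_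
    · exact (hI₁.const_mul 2⁻¹).congr (Eventually.of_forall fun y ↦ by ring)
    · exact (((hI₂.const_mul 2).add hI₃).add hId).congr (Eventually.of_forall fun y ↦ by
        simp only [Pi.add_apply]; ring)
    · show sqrtDetGram G b y * (2⁻¹ * f₁ y) ≤ sqrtDetGram G b y * (2 * f₂ y + f₃ y + divAt G B y)
      by_cases hy : y ∈ tsupport Y
      · have hyV := hYV hy
        have hpt := hG.weightedKorn_pointwise hyV (hpos y hyV) hY hu (hρ y hyV)
        calc sqrtDetGram G b y * (2⁻¹ * f₁ y)
            ≤ sqrtDetGram G b y * (2 * (Real.exp (2 * u y)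
                * normSqAt G y (symAt ((G y).comp (covDAt G Y y))))
              + (3 * gradSqAt G u y + ρ) * (Real.exp (2 * u y) * G y (Y y) (Y y))
              + divAt G (fun z ↦ Real.exp (2 * u z) •
                  ((divAt G Y z) • Y z - covDAt G Y z (Y z))) y) :=
              mul_le_mul_of_nonneg_left hpt (Real.sqrt_nonneg _)
          _ = sqrtDetGram G b y * (2 * f₂ y + f₃ y + divAt G B y) := by
              simp only [hf₂, hf₃, hBdef]; ring
      · rw [hf₁0 y hy, hf₂0 y hy, hf₃0 y hy, hdivB0 y hy]; simp
  have hsplit : ∫ y, sqrtDetGram G b y * (2 * f₂ y + f₃ y + divAt G B y) ∂μ =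
      2 * ∫ y, sqrtDetGram G b y * f₂ y ∂μ + ∫ y, sqrtDetGram G b y * f₃ y ∂μ
        + ∫ y, sqrtDetGram G b y * divAt G B y ∂μ := by
    have e1 : (fun y ↦ sqrtDetGram G b y * (2 * f₂ y + f₃ y + divAt G B y)) =
        fun y ↦ (2 * (sqrtDetGram G b y * f₂ y) + sqrtDetGram G b y * f₃ y)
          + sqrtDetGram G b y * divAt G B y := by
      funext y; ring
    have hfg : Integrable (fun y ↦ 2 * (sqrtDetGram G b y * f₂ y) + sqrtDetGram G b y * f₃ y) μ :=
      (hI₂.const_mul 2).add hI₃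
    rw [e1, integral_add hfg hId, integral_add (hI₂.const_mul 2) hI₃, integral_const_mul]
  have hhalf : ∫ y, sqrtDetGram G b y * (2⁻¹ * f₁ y) ∂μ = 2⁻¹ * ∫ y, sqrtDetGram G b y * f₁ y ∂μ := by
    rw [← integral_const_mul]
    exact integral_congr_ae (Eventually.of_forall fun y ↦ by ring)
  rw [hsplit, hdiv0, add_zero, hhalf] at hmono
  have key : ∫ y, sqrtDetGram G b y * f₁ y ∂μ ≤
      4 * ∫ y, sqrtDetGram G b y * f₂ y ∂μ + 2 * ∫ y, sqrtDetGram G b y * f₃ y ∂μ := by linarith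
  simpa only [hf₁, hf₂, hf₃] using key

end Integral

end MetricCoord

end Literature.Geometry.Lorentzian

end
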